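import Summits.ValiantsHypothesis.ValiantsHypothesis.Theorems.ValuativeGCTValuativeFlipCyclicTridiagonalContinuant

/-!
# LOG-CONCAVITY OF THE LDLᵀ PIVOTS of a continuant with positive diagonal data and non-negative link weights
# along geometric interpolations (Part 1 of the PD-interval / bottom-class law for static definite tridiagonal designs)

HONEST FRAMING.  Helper theorems (`--supports stmt-ValiantsHypothesis-19561 --as helper`; seat val-sym-lift-p2 g9, cell
`pub-symmetroid`, 2026-08-27) — the ABSTRACT half of an all-sizes structure theorem on the REAL side of the desk's typed α target
(lead R2102/R2114, static definite tridiagonal monomial matrices).  Pure real analysis of the tree's continuant `ValuativeFlip.ctK`;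
nothing here bounds the number of zeros of anything, and nothing bears on `WeakLifting` (stmt-19561) / `TropicalB` (stmt-19771) in their
windows, Conjecture B, the Door-A registers, `MatrixDescartes` (stmt-ValiantsHypothesis-18050) or VP ≠ VNP.  Part 2
(`…StaticTridiagonalDefiniteInterval`) specialises to the design's monomial sequences and states the PD-INTERVAL THEOREM and the
BOTTOM-CLASS LAW «Z₀ ≤ 2» in the α target's currency.

WHAT IS PROVED.
1. `holder_two`, `sub_rpow_mul_sub_rpow_le` — the two-term Hölder inequality `a₁^p b₁^q + a₂^p b₂^q ≤ (a₁+a₂)^p (b₁+b₂)^q`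
   (`p, q > 0`, `p + q = 1`; from Mathlib's weighted AM–GM) and its difference form
   `(u − v)^p (u' − v')^q ≤ u^p u'^q − v^p v'^q`; `monomial_interp` — `a (x^p z^q)^n = (a x^n)^p (a z^n)^q`;
   `exists_rpow_interp` — any `0 < x < y < z` is `y = x^p z^q` with `p, q > 0`, `p + q = 1`.
2. For the continuant `K₀ = 1, K₁ = L 0, K_{k+2} = L (k+1) K_{k+1} + M k · N (k+1) · K_k` with `L > 0` and LINK WEIGHTS
   `w_k := −(M k · N (k+1)) ≥ 0`, and three data sets of which the third is the `(p, q)` geometric interpolation of the first two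
   (`L = L₁^p L₂^q`, `w = w₁^p w₂^q`): `ctK_pivot_succ` (pivot recursion `π_{k+2} = L (k+1) − w_k / π_{k+1}`), `pivot_step` (the Hölder
   step), **`ctK_interp`** — if the continuants of the two endpoints are positive up to level `n+1` then so are the interpolated ones and
   the PIVOTS ARE LOG-CONCAVE: `π₁_{n+1}^p · π₂_{n+1}^q ≤ π_{n+1}`; corollaries `ctK_pos_interp` (positivity propagates) and
   `ctK_nonneg_interp` (proper continuants positive and the last one non-negative at both endpoints ⇒ the same in between).
[folklore: Hölder's inequality; continuants / LDLᵀ; the log-concavity observation is this seat's.]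
-/

set_option linter.dupNamespace false
set_option autoImplicit false

namespace Summit.ValiantsHypothesis.ValiantsHypothesis.Theorems.KPlusLogSqLaw.DefiniteInterpolation

open Summit.ValiantsHypothesis.ValiantsHypothesis.Theorems.ValuativeFlip (ctK ctK_zero ctK_one ctK_add_two)

/-! ### The two-term Hölder inequality and its consequences -/

/-- **Two-term Hölder inequality** (`p, q > 0`, `p + q = 1`, all entries non-negative):
`a₁^p b₁^q + a₂^p b₂^q ≤ (a₁ + a₂)^p (b₁ + b₂)^q`.  From the weighted AM–GM inequality applied to the normalised terms.
[folklore: Hölder] -/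
theorem holder_two {a₁ a₂ b₁ b₂ p q : ℝ} (ha₁ : 0 ≤ a₁) (ha₂ : 0 ≤ a₂) (hb₁ : 0 ≤ b₁) (hb₂ : 0 ≤ b₂)
    (hp : 0 < p) (hq : 0 < q) (hpq : p + q = 1) :
    a₁ ^ p * b₁ ^ q + a₂ ^ p * b₂ ^ q ≤ (a₁ + a₂) ^ p * (b₁ + b₂) ^ q := by
  rcases (add_nonneg ha₁ ha₂).eq_or_lt with hA | hA
  · have h1 : a₁ = 0 := by linarith
    have h2 : a₂ = 0 := by linarith
    rw [h1, h2, add_zero, Real.zero_rpow hp.ne', zero_mul, zero_mul, zero_mul, add_zero]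
  rcases (add_nonneg hb₁ hb₂).eq_or_lt with hB | hB
  · have h1 : b₁ = 0 := by linarith
    have h2 : b₂ = 0 := by linarith
    rw [h1, h2, add_zero, Real.zero_rpow hq.ne', mul_zero, mul_zero, mul_zero, add_zero]
  have hAp : 0 < (a₁ + a₂) ^ p := Real.rpow_pos_of_pos hA p
  have hBq : 0 < (b₁ + b₂) ^ q := Real.rpow_pos_of_pos hB q
  have key : ∀ a b : ℝ, 0 ≤ a → 0 ≤ b →
      a ^ p * b ^ q ≤ (p * (a / (a₁ + a₂)) + q * (b / (b₁ + b₂))) * ((a₁ + a₂) ^ p * (b₁ + b₂) ^ q) := by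
    intro a b ha hb
    have h := Real.geom_mean_le_arith_mean2_weighted hp.le hq.le (div_nonneg ha hA.le) (div_nonneg hb hB.le) hpq
    rw [Real.div_rpow ha hA.le, Real.div_rpow hb hB.le, div_mul_div_comm, div_le_iff₀ (mul_pos hAp hBq)] at h
    exact h
  calc a₁ ^ p * b₁ ^ q + a₂ ^ p * b₂ ^ q
      ≤ (p * (a₁ / (a₁ + a₂)) + q * (b₁ / (b₁ + b₂))) * ((a₁ + a₂) ^ p * (b₁ + b₂) ^ q) +
          (p * (a₂ / (a₁ + a₂)) + q * (b₂ / (b₁ + b₂))) * ((a₁ + a₂) ^ p * (b₁ + b₂) ^ q) :=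
        add_le_add (key a₁ b₁ ha₁ hb₁) (key a₂ b₂ ha₂ hb₂)
    _ = (p * ((a₁ + a₂) / (a₁ + a₂)) + q * ((b₁ + b₂) / (b₁ + b₂))) * ((a₁ + a₂) ^ p * (b₁ + b₂) ^ q) := by
        ring
    _ = (a₁ + a₂) ^ p * (b₁ + b₂) ^ q := by
        rw [div_self hA.ne', div_self hB.ne', mul_one, mul_one, hpq, one_mul]

/-- **Difference form of the two-term Hölder inequality**: for `0 ≤ v ≤ u`, `0 ≤ v' ≤ u'`,
`(u − v)^p (u' − v')^q ≤ u^p u'^q − v^p v'^q`. [folklore: Hölder] -/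
theorem sub_rpow_mul_sub_rpow_le {u v u' v' p q : ℝ} (hv : 0 ≤ v) (hvu : v ≤ u) (hv' : 0 ≤ v') (hvu' : v' ≤ u')
    (hp : 0 < p) (hq : 0 < q) (hpq : p + q = 1) :
    (u - v) ^ p * (u' - v') ^ q ≤ u ^ p * u' ^ q - v ^ p * v' ^ q := by
  have h := holder_two (sub_nonneg.mpr hvu) hv (sub_nonneg.mpr hvu') hv' hp hq hpq
  rw [sub_add_cancel, sub_add_cancel] at h
  linarith

/-- **Monomials interpolate geometrically**: for `a ≥ 0`, `x, z > 0` and `p + q = 1` (`p, q > 0`),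
`a · (x^p z^q)^n = (a x^n)^p (a z^n)^q`. [folklore] -/
theorem monomial_interp {a x z p q : ℝ} (ha : 0 ≤ a) (hx : 0 < x) (hz : 0 < z)
    (hp : 0 < p) (hpq : p + q = 1) (n : ℕ) :
    a * (x ^ p * z ^ q) ^ n = (a * x ^ n) ^ p * (a * z ^ n) ^ q := by
  rcases ha.eq_or_lt with ha0 | ha0
  · rw [← ha0, zero_mul, zero_mul, zero_mul, Real.zero_rpow hp.ne', zero_mul]
  rw [Real.mul_rpow ha (pow_nonneg hx.le n), Real.mul_rpow ha (pow_nonneg hz.le n), mul_pow,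
    ← Real.rpow_natCast (x ^ p) n, ← Real.rpow_natCast (z ^ q) n, ← Real.rpow_mul hx.le, ← Real.rpow_mul hz.le,
    ← Real.rpow_natCast x n, ← Real.rpow_natCast z n, ← Real.rpow_mul hx.le, ← Real.rpow_mul hz.le,
    mul_comm (n : ℝ) p, mul_comm (n : ℝ) q]
  have hapq : a ^ p * a ^ q = a := by rw [← Real.rpow_add ha0, hpq, Real.rpow_one]
  calc a * (x ^ (p * (n : ℝ)) * z ^ (q * (n : ℝ)))
      = (a ^ p * a ^ q) * (x ^ (p * (n : ℝ)) * z ^ (q * (n : ℝ))) := by rw [hapq]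
    _ = a ^ p * x ^ (p * (n : ℝ)) * (a ^ q * z ^ (q * (n : ℝ))) := by ring

/-- **Three positive reals in order are a geometric interpolation**: if `0 < x < y < z` then `y = x^p z^q` for some
`p, q > 0` with `p + q = 1`. [folklore] -/
theorem exists_rpow_interp {x y z : ℝ} (hx : 0 < x) (hxy : x < y) (hyz : y < z) :
    ∃ p q : ℝ, 0 < p ∧ 0 < q ∧ p + q = 1 ∧ x ^ p * z ^ q = y := by
  have hy : 0 < y := hx.trans hxy
  have hz : 0 < z := hy.trans hyz
  have hlxy : Real.log x < Real.log y := Real.log_lt_log hx hxy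
  have hlyz : Real.log y < Real.log z := Real.log_lt_log hy hyz
  have hD : 0 < Real.log z - Real.log x := by linarith
  refine ⟨(Real.log z - Real.log y) / (Real.log z - Real.log x),
    (Real.log y - Real.log x) / (Real.log z - Real.log x), div_pos (by linarith) hD, div_pos (by linarith) hD, ?_, ?_⟩
  · rw [← add_div, div_eq_one_iff_eq hD.ne']
    ring
  · rw [Real.rpow_def_of_pos hx, Real.rpow_def_of_pos hz, ← Real.exp_add]
    nth_rw 3 [← Real.exp_log hy]
    congr 1
    field_simp
    ring


/-! ### Log-concavity of the pivots of a continuant (positive diagonal, non-positive link products)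

Throughout, `ctK L M N k` is the tree's continuant `K₀ = 1`, `K₁ = L 0`, `K_{k+2} = L (k+1) K_{k+1} + M k · N (k+1) · K_k`
(`ValuativeFlip.ctK`); the LINK WEIGHT of step `k` is `w_k := −(M k · N (k+1))`, so `K_{k+2} = L (k+1) K_{k+1} − w_k K_k`, and the
PIVOT is `π_{k+1} := K_{k+1} / K_k` (`π_1 = L 0`, `π_{k+2} = L (k+1) − w_k / π_{k+1}`).  Three data sets are compared: two «endpoints»
`(L₁, M₁, N₁)`, `(L₂, M₂, N₂)` and the «geometric interpolation» `(L, M, N)` with `L k = (L₁ k)^p (L₂ k)^q`, `w_k = (w₁_k)^p (w₂_k)^q`. -/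

section Continuant

variable {L₁ M₁ N₁ L₂ M₂ N₂ L M N : ℕ → ℝ} {p q : ℝ}

/-- **Pivot recursion** `π_{n+2} = L (n+1) − w_n / π_{n+1}` (for `K_n, K_{n+1} ≠ 0`). [folklore: continuant / LDLᵀ] -/
theorem ctK_pivot_succ (L M N : ℕ → ℝ) (n : ℕ) (hs : ctK L M N (n + 1) ≠ 0) :
    ctK L M N (n + 2) / ctK L M N (n + 1) =
      L (n + 1) - (-(M n * N (n + 1))) / (ctK L M N (n + 1) / ctK L M N n) := by
  rw [ctK_add_two]
  field_simp
  ring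

/-- **The Hölder step**: if the pivot inequality `π₁_{n+1}^p π₂_{n+1}^q ≤ π_{n+1}` holds at level `n+1` (all three pivots positive) and
the next endpoint pivots are non-negative, then it holds at level `n+2`. [this file] -/
theorem pivot_step (hp : 0 < p) (hq : 0 < q) (hpq : p + q = 1) (n : ℕ)
    (hL : L (n + 1) = L₁ (n + 1) ^ p * L₂ (n + 1) ^ q)
    (hw₁ : 0 ≤ -(M₁ n * N₁ (n + 1))) (hw₂ : 0 ≤ -(M₂ n * N₂ (n + 1)))
    (hw : -(M n * N (n + 1)) = (-(M₁ n * N₁ (n + 1))) ^ p * (-(M₂ n * N₂ (n + 1))) ^ q)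
    (h₁n : 0 < ctK L₁ M₁ N₁ n) (h₁s : 0 < ctK L₁ M₁ N₁ (n + 1)) (h₁ss : 0 ≤ ctK L₁ M₁ N₁ (n + 2))
    (h₂n : 0 < ctK L₂ M₂ N₂ n) (h₂s : 0 < ctK L₂ M₂ N₂ (n + 1)) (h₂ss : 0 ≤ ctK L₂ M₂ N₂ (n + 2))
    (hn : 0 < ctK L M N n) (hs : 0 < ctK L M N (n + 1))
    (hPi : (ctK L₁ M₁ N₁ (n + 1) / ctK L₁ M₁ N₁ n) ^ p * (ctK L₂ M₂ N₂ (n + 1) / ctK L₂ M₂ N₂ n) ^ q ≤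
      ctK L M N (n + 1) / ctK L M N n) :
    (ctK L₁ M₁ N₁ (n + 2) / ctK L₁ M₁ N₁ (n + 1)) ^ p * (ctK L₂ M₂ N₂ (n + 2) / ctK L₂ M₂ N₂ (n + 1)) ^ q ≤
      ctK L M N (n + 2) / ctK L M N (n + 1) := by
  set r₁ := ctK L₁ M₁ N₁ (n + 1) / ctK L₁ M₁ N₁ n with hr₁
  set r₂ := ctK L₂ M₂ N₂ (n + 1) / ctK L₂ M₂ N₂ n with hr₂
  set r := ctK L M N (n + 1) / ctK L M N n with hr
  set w₁ := -(M₁ n * N₁ (n + 1)) with hw₁def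
  set w₂ := -(M₂ n * N₂ (n + 1)) with hw₂def
  have hr₁pos : 0 < r₁ := div_pos h₁s h₁n
  have hr₂pos : 0 < r₂ := div_pos h₂s h₂n
  have hrpos : 0 < r := div_pos hs hn
  have hprod : 0 < r₁ ^ p * r₂ ^ q := mul_pos (Real.rpow_pos_of_pos hr₁pos p) (Real.rpow_pos_of_pos hr₂pos q)
  have e₁ := ctK_pivot_succ L₁ M₁ N₁ n h₁s.ne'
  have e₂ := ctK_pivot_succ L₂ M₂ N₂ n h₂s.ne'
  have e := ctK_pivot_succ L M N n hs.ne'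
  rw [e₁, e₂, e, hL, hw, ← hr₁, ← hr₂, ← hr, ← hw₁def, ← hw₂def]
  -- the next endpoint pivots are non-negative
  have hv₁ : w₁ / r₁ ≤ L₁ (n + 1) := by
    have : 0 ≤ ctK L₁ M₁ N₁ (n + 2) / ctK L₁ M₁ N₁ (n + 1) := div_nonneg h₁ss h₁s.le
    rw [e₁, ← hr₁, ← hw₁def] at this
    exact sub_nonneg.mp this
  have hv₂ : w₂ / r₂ ≤ L₂ (n + 1) := by
    have : 0 ≤ ctK L₂ M₂ N₂ (n + 2) / ctK L₂ M₂ N₂ (n + 1) := div_nonneg h₂ss h₂s.le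
    rw [e₂, ← hr₂, ← hw₂def] at this
    exact sub_nonneg.mp this
  have step1 := sub_rpow_mul_sub_rpow_le (div_nonneg hw₁ hr₁pos.le) hv₁ (div_nonneg hw₂ hr₂pos.le) hv₂ hp hq hpq
  have step2 : (w₁ / r₁) ^ p * (w₂ / r₂) ^ q = (w₁ ^ p * w₂ ^ q) / (r₁ ^ p * r₂ ^ q) := by
    rw [Real.div_rpow hw₁ hr₁pos.le, Real.div_rpow hw₂ hr₂pos.le, div_mul_div_comm]
  have step3 : (w₁ ^ p * w₂ ^ q) / r ≤ (w₁ ^ p * w₂ ^ q) / (r₁ ^ p * r₂ ^ q) :=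
    div_le_div_of_nonneg_left (mul_nonneg (Real.rpow_nonneg hw₁ p) (Real.rpow_nonneg hw₂ q)) hprod hPi
  rw [step2] at step1
  linarith

/-- **Log-concavity of the pivots along a geometric interpolation** (the induction): if the continuants `K₁_k`, `K₂_k` of the two
endpoints are positive for `k ≤ n+1`, then so are the interpolated `K_k`, and `π₁_{n+1}^p · π₂_{n+1}^q ≤ π_{n+1}`. [this file] -/
theorem ctK_interp (hp : 0 < p) (hq : 0 < q) (hpq : p + q = 1)
    (hL₁ : ∀ k, 0 < L₁ k) (hL₂ : ∀ k, 0 < L₂ k) (hL : ∀ k, L k = L₁ k ^ p * L₂ k ^ q)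
    (hw₁ : ∀ k, 0 ≤ -(M₁ k * N₁ (k + 1))) (hw₂ : ∀ k, 0 ≤ -(M₂ k * N₂ (k + 1)))
    (hw : ∀ k, -(M k * N (k + 1)) = (-(M₁ k * N₁ (k + 1))) ^ p * (-(M₂ k * N₂ (k + 1))) ^ q) :
    ∀ n : ℕ, (∀ k ≤ n + 1, 0 < ctK L₁ M₁ N₁ k) → (∀ k ≤ n + 1, 0 < ctK L₂ M₂ N₂ k) →
      (∀ k ≤ n + 1, 0 < ctK L M N k) ∧
        (ctK L₁ M₁ N₁ (n + 1) / ctK L₁ M₁ N₁ n) ^ p * (ctK L₂ M₂ N₂ (n + 1) / ctK L₂ M₂ N₂ n) ^ q ≤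
          ctK L M N (n + 1) / ctK L M N n := by
  intro n
  induction n with
  | zero =>
    intro _ _
    have h0 : ctK L M N 1 = L₁ 0 ^ p * L₂ 0 ^ q := by rw [ctK_one, hL 0]
    refine ⟨fun k hk => ?_, ?_⟩
    · interval_cases k
      · rw [ctK_zero]; exact one_pos
      · rw [h0]; exact mul_pos (Real.rpow_pos_of_pos (hL₁ 0) p) (Real.rpow_pos_of_pos (hL₂ 0) q)
    · rw [ctK_one, ctK_zero, ctK_one, ctK_zero, h0, ctK_zero, div_one, div_one, div_one]
  | succ n ih =>
    intro hK₁ hK₂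
    obtain ⟨hK, hPi⟩ := ih (fun k hk => hK₁ k (by omega)) (fun k hk => hK₂ k (by omega))
    have hstep := pivot_step hp hq hpq n (hL (n + 1)) (hw₁ n) (hw₂ n) (hw n)
      (hK₁ n (by omega)) (hK₁ (n + 1) (by omega)) (hK₁ (n + 2) le_rfl).le
      (hK₂ n (by omega)) (hK₂ (n + 1) (by omega)) (hK₂ (n + 2) le_rfl).le
      (hK n (by omega)) (hK (n + 1) le_rfl) hPi
    have hpos : 0 < ctK L M N (n + 2) := by
      have hlow : 0 < (ctK L₁ M₁ N₁ (n + 2) / ctK L₁ M₁ N₁ (n + 1)) ^ p *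
          (ctK L₂ M₂ N₂ (n + 2) / ctK L₂ M₂ N₂ (n + 1)) ^ q :=
        mul_pos (Real.rpow_pos_of_pos (div_pos (hK₁ (n + 2) le_rfl) (hK₁ (n + 1) (by omega))) p)
          (Real.rpow_pos_of_pos (div_pos (hK₂ (n + 2) le_rfl) (hK₂ (n + 1) (by omega))) q)
      have hq' : 0 < ctK L M N (n + 2) / ctK L M N (n + 1) := hlow.trans_le hstep
      have := mul_pos hq' (hK (n + 1) le_rfl)
      rwa [div_mul_cancel₀ _ (hK (n + 1) le_rfl).ne'] at this
    refine ⟨fun k hk => ?_, hstep⟩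
    rcases Nat.lt_or_ge k (n + 2) with h | h
    · exact hK k (by omega)
    · have : k = n + 2 := by omega
      rw [this]; exact hpos

/-- **PD-interpolation for continuants**: if every continuant `K₁_k, K₂_k` (`k ≤ n`) of the two endpoints is positive, so is every
interpolated `K_k` (`k ≤ n`). [this file] -/
theorem ctK_pos_interp (hp : 0 < p) (hq : 0 < q) (hpq : p + q = 1)
    (hL₁ : ∀ k, 0 < L₁ k) (hL₂ : ∀ k, 0 < L₂ k) (hL : ∀ k, L k = L₁ k ^ p * L₂ k ^ q)
    (hw₁ : ∀ k, 0 ≤ -(M₁ k * N₁ (k + 1))) (hw₂ : ∀ k, 0 ≤ -(M₂ k * N₂ (k + 1)))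
    (hw : ∀ k, -(M k * N (k + 1)) = (-(M₁ k * N₁ (k + 1))) ^ p * (-(M₂ k * N₂ (k + 1))) ^ q)
    (n : ℕ) (hK₁ : ∀ k ≤ n, 0 < ctK L₁ M₁ N₁ k) (hK₂ : ∀ k ≤ n, 0 < ctK L₂ M₂ N₂ k) :
    ∀ k ≤ n, 0 < ctK L M N k := by
  rcases n with _ | n
  · intro k hk
    have : k = 0 := by omega
    rw [this, ctK_zero]; exact one_pos
  · exact (ctK_interp hp hq hpq hL₁ hL₂ hL hw₁ hw₂ hw n hK₁ hK₂).1

/-- **Semidefinite endpoints**: if `K₁_k, K₂_k > 0` for `k < n` and `K₁_n, K₂_n ≥ 0`, then `K_k > 0` for `k < n` and `K_n ≥ 0`.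
[this file] -/
theorem ctK_nonneg_interp (hp : 0 < p) (hq : 0 < q) (hpq : p + q = 1)
    (hL₁ : ∀ k, 0 < L₁ k) (hL₂ : ∀ k, 0 < L₂ k) (hL : ∀ k, L k = L₁ k ^ p * L₂ k ^ q)
    (hw₁ : ∀ k, 0 ≤ -(M₁ k * N₁ (k + 1))) (hw₂ : ∀ k, 0 ≤ -(M₂ k * N₂ (k + 1)))
    (hw : ∀ k, -(M k * N (k + 1)) = (-(M₁ k * N₁ (k + 1))) ^ p * (-(M₂ k * N₂ (k + 1))) ^ q)
    (n : ℕ) (hK₁ : ∀ k < n, 0 < ctK L₁ M₁ N₁ k) (hK₂ : ∀ k < n, 0 < ctK L₂ M₂ N₂ k)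
    (hK₁n : 0 ≤ ctK L₁ M₁ N₁ n) (hK₂n : 0 ≤ ctK L₂ M₂ N₂ n) :
    (∀ k < n, 0 < ctK L M N k) ∧ 0 ≤ ctK L M N n := by
  rcases n with _ | _ | n
  · refine ⟨fun k hk => absurd hk (Nat.not_lt_zero k), ?_⟩
    rw [ctK_zero]; exact zero_le_one
  · refine ⟨fun k hk => ?_, ?_⟩
    · have : k = 0 := by omega
      rw [this, ctK_zero]; exact one_pos
    · rw [ctK_one, hL 0]
      exact mul_nonneg (Real.rpow_nonneg (hL₁ 0).le p) (Real.rpow_nonneg (hL₂ 0).le q)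
  · obtain ⟨hK, hPi⟩ := ctK_interp hp hq hpq hL₁ hL₂ hL hw₁ hw₂ hw n
      (fun k hk => hK₁ k (by omega)) (fun k hk => hK₂ k (by omega))
    have hstep := pivot_step hp hq hpq n (hL (n + 1)) (hw₁ n) (hw₂ n) (hw n)
      (hK₁ n (by omega)) (hK₁ (n + 1) (by omega)) hK₁n
      (hK₂ n (by omega)) (hK₂ (n + 1) (by omega)) hK₂n
      (hK n (by omega)) (hK (n + 1) le_rfl) hPi
    refine ⟨fun k hk => hK k (by omega), ?_⟩
    have hlow : 0 ≤ (ctK L₁ M₁ N₁ (n + 2) / ctK L₁ M₁ N₁ (n + 1)) ^ p *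
        (ctK L₂ M₂ N₂ (n + 2) / ctK L₂ M₂ N₂ (n + 1)) ^ q :=
      mul_nonneg (Real.rpow_nonneg (div_nonneg hK₁n (hK₁ (n + 1) (by omega)).le) p)
        (Real.rpow_nonneg (div_nonneg hK₂n (hK₂ (n + 1) (by omega)).le) q)
    have hq' : 0 ≤ ctK L M N (n + 2) / ctK L M N (n + 1) := hlow.trans hstep
    have := mul_nonneg hq' (hK (n + 1) le_rfl).le
    rwa [div_mul_cancel₀ _ (hK (n + 1) le_rfl).ne'] at this

end Continuant

end Summit.ValiantsHypothesis.ValiantsHypothesis.Theorems.KPlusLogSqLaw.DefiniteInterpolation
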